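import Summits.ValiantsHypothesis.ValiantsHypothesis.Theorems.KPlusLogSqLawTropicalGradedWalkDefs


/-!
# Route «KPlusLogSqLaw» — GRW-lite (all-`m` `K = 4` family), part P-D: the row potentials of the DIAGONAL states of the phases `w < m`

HONEST FRAMING.  Helper file of the chain `--supports` the crux `Summit.ValiantsHypothesis.ValiantsHypothesis.Theses.KPlusLogSqLaw.TropicalB`
(item `stmt-ValiantsHypothesis-19771`, route `KPlusLogSqLaw`; cell `pub-symmetroid`, seat val-sym-trop-p3 g14, 2026-08-28), on top of the
definitions file `…TropicalGradedWalkDefs.lean`.  It proves nothing about `TropicalB`, `WeakLifting`, `MatrixDescartes` or `VP ≠ VNP`.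

CONTENT.  The DUAL CERTIFICATE for the dominance of the diagonal state `(w, u, 0)` (`u < w < m`, slope `θ = L·w + M·u`, `thD`) of the
GRW-lite design is a pair of potentials for `TropicalCensus.isDominant_of_scaledPotential` (scale `1`): the ROW potential
`UD a = g·θ·a + muD (a − (m − w))` (a linear gauge `g·θ·a` plus a BEND on the block rows) and the column potential defined by tightness.
The bend is the cumulative sum of the steps `UB₂(j)` (`j < u`: «the column-`j` cell one row up has slack exactly 1»), `UB₁(u)`, and
`LB₁(j)` (`j > u`: «the column-`(j−1)` cell one row down has slack exactly 1»); this file records these sums in CLOSED FORM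
(`SUB2`, `SUBu`, `SLB`, `SLB0`, via `T2 k = C(k,2)` and `T6 k = Σ_{i<k} i²`, whose closed forms `two_mul_T2` / `six_mul_T6` are proved
here), the piecewise bend `muD` and `UD`, and the if-free forms `tau2lt` / `tau3lt` of the switch times below the top level with the
integer exponents `d1, d2, d3`.  The slack inequalities (one lemma per rival family, each an exact polynomial identity plus a
non-negativity certificate) are in the companion files `…GradedWalkDomD*.lean`; located basis: exact integer checks of the whole
certificate for every `m ≤ 16` (seat tools cert3.py / catalogD.py).
-/

set_option linter.dupNamespace false
set_option autoImplicit false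

namespace Summit.ValiantsHypothesis.ValiantsHypothesis.Theorems.LacunarySymmetroidMatrixDescartes.TropicalCensus

namespace GradedWalk

variable (n : ℕ)
/-! ### closed forms of the bookkeeping sums -/

/-- `2·T2 k = k(k − 1)`. -/
theorem two_mul_T2 (k : ℕ) : 2 * T2 k = (k : ℤ) * ((k : ℤ) - 1) := by
  induction k with
  | zero => simp [T2]
  | succ k ih => rw [T2]; push_cast; nlinarith [ih]

/-- `6·T6 k = (k − 1)k(2k − 1)`. -/
theorem six_mul_T6 (k : ℕ) : 6 * T6 k = ((k : ℤ) - 1) * (k : ℤ) * (2 * (k : ℤ) - 1) := by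
  induction k with
  | zero => simp [T6]
  | succ k ih => rw [T6]; push_cast; nlinarith [ih]

/-! ### type-D potentials (diagonal states `(w, u, 0)` of the phases `w < m`) -/

/-- exponent of class `1` as an integer. -/
def d1 : ℤ := (AA n : ℤ)
/-- exponent of class `2`. -/
def d2 : ℤ := (AA n : ℤ) + bB n
/-- exponent of class `3`. -/
def d3 : ℤ := (AA n : ℤ) + bB n + 1
/-- `τ₂` below the top level (if-free form of `tau2`). -/
def tau2lt (E b : ℕ) : ℤ := LL n * E + MM n * b + 5
/-- `τ₃` below the top level (if-free form of `tau3`). -/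
def tau3lt (E b : ℕ) : ℤ := LL n * E + MM n * E + 2 * b + 1
/-- slope of the diagonal state `(w, u, 0)` of a phase `w < m`: `L·w + M·u`. -/
def thD (w u : ℕ) : ℤ := LL n * w + MM n * u
/-- bend of the row potential over the block rows `1..jj`, `jj ≤ u − 1`: `Σ_{i ≤ jj} UB₂(i)`. -/
def SUB2 (w u jj : ℕ) : ℤ :=
  ((((-2 : ℤ) * T2 ((jj + 1)) * mZ n * (w : ℤ) + ((-10 : ℤ) * T2 ((jj + 1)) * mZ n ^ 2 + (-4 : ℤ) * (jj : ℤ) * mZ n * (u : ℤ))) + ((2 : ℤ) * (jj : ℤ) * mZ n * (w : ℤ) + ((4 : ℤ) * (jj : ℤ) * mZ n ^ 2 + (-32 : ℤ) * T2 ((jj + 1)) * mZ n))) + (((-6 : ℤ) * T2 ((jj + 1)) * (w : ℤ) + ((2 : ℤ) * T6 ((jj + 1)) * mZ n + (12 : ℤ) * (jj : ℤ) * mZ n)) + (((-12 : ℤ) * (jj : ℤ) * (u : ℤ) + (6 : ℤ) * (jj : ℤ) * (w : ℤ)) + ((-4 : ℤ) * T2 ((jj + 1)) + (5 : ℤ)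 * T6 ((jj + 1))))))
/-- bend at block row `u` (`u ≥ 1`): `Σ_{i < u} UB₂(i) + UB₁(u)`. -/
def SUBu (w u : ℕ) : ℤ :=
  ((((-2 : ℤ) * T2 (u) * mZ n * (w : ℤ) + ((-10 : ℤ) * T2 (u) * mZ n ^ 2 + (-2 : ℤ) * mZ n * (u : ℤ) ^ 2)) + (((-6 : ℤ) * mZ n ^ 2 * (u : ℤ) + (-32 : ℤ) * T2 (u) * mZ n) + ((-6 : ℤ) * T2 (u) * (w : ℤ) + (2 : ℤ) * T6 (u) * mZ n))) + (((-20 : ℤ) * mZ n * (u : ℤ) + ((-7 : ℤ) * (u : ℤ) ^ 2 + (-4 : ℤ) * T2 (u))) + (((5 : ℤ) * T6 (u) + (5 : ℤ) * mZ n) + ((-4 : ℤ) * (u : ℤ) + (5 : ℤ)))))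
/-- bend increment over the block rows `u+1..jj`: `Σ_{u < i ≤ jj} LB₁(i)`. -/
def SLB (w u jj : ℕ) : ℤ :=
  (((((-2 : ℤ) * T2 ((jj + 1)) * mZ n * (w : ℤ) + ((-10 : ℤ) * T2 ((jj + 1)) * mZ n ^ 2 + (2 : ℤ) * T2 ((u + 1)) * mZ n * (w : ℤ))) + (((10 : ℤ) * T2 ((u + 1)) * mZ n ^ 2 + (-2 : ℤ) * (jj : ℤ) * mZ n * (u : ℤ)) + ((2 : ℤ) * (jj : ℤ) * mZ n * (w : ℤ) + (6 : ℤ) * (jj : ℤ) * mZ n ^ 2))) + (((-2 : ℤ) * mZ n * (u : ℤ) * (w : ℤ) + ((2 : ℤ) * mZ n * (u : ℤ) ^ 2 + (-6 : ℤ) * mZ n ^ 2 * (u : ℤ))) + (((-34 : ℤ) * T2 ((jj + 1)) * mZ n + (-6 : ℤ) * T2 ((jj + 1)) * (w : ℤ)) + ((34 : ℤ) * T2 ((u + 1)) * mZ n + (6 : ℤ) * T2 ((u + 1)) * (w : ℤ))))) + ((((2 : ℤ) * T6 ((jj + 1)) * mZ n + ((-2 : ℤ) * T6 ((u + 1)) *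 mZ n + (20 : ℤ) * (jj : ℤ) * mZ n)) + (((-6 : ℤ) * (jj : ℤ) * (u : ℤ) + (6 : ℤ) * (jj : ℤ) * (w : ℤ)) + ((-20 : ℤ) * mZ n * (u : ℤ) + (-6 : ℤ) * (u : ℤ) * (w : ℤ)))) + (((6 : ℤ) * (u : ℤ) ^ 2 + ((-10 : ℤ) * T2 ((jj + 1)) + (10 : ℤ) * T2 ((u + 1)))) + (((5 : ℤ) * T6 ((jj + 1)) + (-5 : ℤ) * T6 ((u + 1))) + ((6 : ℤ) * (jj : ℤ) + (-6 : ℤ) * (u : ℤ))))))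
/-- bend for `u = 0` over the block rows `1..jj`: `Σ_{i ≤ jj} LB₁(i)`. -/
def SLB0 (w jj : ℕ) : ℤ :=
  ((((-2 : ℤ) * T2 ((jj + 1)) * mZ n * (w : ℤ) + ((-10 : ℤ) * T2 ((jj + 1)) * mZ n ^ 2 + (2 : ℤ) * (jj : ℤ) * mZ n * (w : ℤ))) + ((6 : ℤ) * (jj : ℤ) * mZ n ^ 2 + ((-34 : ℤ) * T2 ((jj + 1)) * mZ n + (-6 : ℤ) * T2 ((jj + 1)) * (w : ℤ)))) + (((2 : ℤ) * T6 ((jj + 1)) * mZ n + ((20 : ℤ) * (jj : ℤ) * mZ n + (6 : ℤ) * (jj : ℤ) * (w : ℤ))) + ((-10 : ℤ) * T2 ((jj + 1)) + ((5 : ℤ) * T6 ((jj + 1)) + (6 : ℤ) * (jj : ℤ)))))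

/-- the bend of the row potential of the diagonal state `(w, u, 0)` at block row `j` (`j = 0`: no bend). -/
def muD (w u j : ℕ) : ℤ :=
  if j < u then SUB2 n w u j else if u = 0 then SLB0 n w j else SUBu n w u + SLB n w u j

/-- the row potential of the diagonal state `(w, u, 0)`: linear gauge plus the bend on the block rows `a ≥ m − w`. -/
def UD (w u a : ℕ) : ℤ := gG n * thD n w u * a + muD n w u (a - (n + 1 - w))

/-! ### small interface lemmas -/

/-- below the top level `τ₂` is `tau2lt`. -/
theorem tau2_of_ne {E : ℕ} (h : E ≠ n + 1) (b : ℕ) : tau2 n E b = tau2lt n E b := by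
  unfold tau2 tau2lt; rw [if_neg h]

/-- below the top level `τ₃` is `tau3lt`. -/
theorem tau3_of_ne {E : ℕ} (h : E ≠ n + 1) (b : ℕ) : tau3 n E b = tau3lt n E b := by
  unfold tau3 tau3lt; rw [if_neg h]

/-- the exponents as integers. -/
theorem dd_cast_one : ((dd n 1 : ℕ) : ℤ) = d1 n := by simp [dd, d1]

/-- the exponents as integers. -/
theorem dd_cast_two : ((dd n 2 : ℕ) : ℤ) = d2 n := by simp [dd, d2, bB]

/-- the exponents as integers. -/
theorem dd_cast_three : ((dd n 3 : ℕ) : ℤ) = d3 n := by simp [dd, d3, bB]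

/-- the exponents as integers. -/
theorem dd_cast_zero : ((dd n 0 : ℕ) : ℤ) = 0 := by simp [dd]

/-- the slope of the diagonal state `(w, u, 0)`, `u < w < m`, is `thD`. -/
theorem theta_D {w u : ℕ} (huw : u < w) (hw : w < n + 1) : theta n w u 0 = thD n w u := by
  unfold theta thD Mw
  rw [if_neg (by omega), if_pos huw]
  push_cast; ring

/-- no bend at or above the junction row. -/
theorem muD_zero (w u : ℕ) : muD n w u 0 = 0 := by
  unfold muD
  split_ifs with h1 h2
  · simp [SUB2, T2, T6]
  · simp [SLB0, T2, T6]
  · exfalso; omega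

end GradedWalk

end Summit.ValiantsHypothesis.ValiantsHypothesis.Theorems.LacunarySymmetroidMatrixDescartes.TropicalCensus
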